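import Mathlib.NumberTheory.Transcendental.Liouville.LiouvilleWith
import Mathlib.NumberTheory.Real.Irrational
import Mathlib.Analysis.SpecialFunctions.Pow.Real
import Mathlib.Analysis.SpecialFunctions.Log.Basic
import Literature.NumberTheory.DiophantineApproximation.ApproximationSequenceMeasure
import HarnessLib

/-!
# ζ(5) search — criterion C4 for ALL denominators and from EVENTUAL data (cell `pub-zeta5`, TYPER)

HONEST FRAMING: systematic search; no irrationality claim unless certified.

`CRITERIA.md` C4, second part. The cell's certificates (FORMAT A `ApproximationCertificate`,
FORMAT B `LinearFormCertificate`) deliver integer sequences `p_r, q_r` with bounds that hold for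
all LARGE `r` (`∀ᶠ`) and with constants: `|q_r| ≤ k e^{Q r}`, `|q_r ξ - p_r| ≤ l e^{-σ r}`,
`p_r q_{r+1} ≠ p_{r+1} q_r`. The tree's closing lemma of the Thue–Siegel method
(`Literature.NumberTheory.DiophantineApproximation.one_div_lt_abs_sub_div_of_approx`,
Chen–Voutier 1997 §2 Lemma 8) wants the bounds for EVERY `r` and gives the measure only for
denominators `|b| ≥ 1/(2 l₀)`. This file closes both gaps by two elementary devices, all PROVED:

* `lt_abs_sub_div_of_rates` — bounds for every `r` ⇒ for ALL integers `a` and `b ≠ 0`: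
  `|ξ - a/b| > 1 / (2 k₀ e^{Q} (2 e^{σ} l₀)^{Q/σ} m^{Q/σ+1} · |b|^{Q/σ+1})` with the integer
  `m = ⌈1/(2 l₀)⌉` (write `a/b = (a m)/(b m)`: the denominator `b m` is large enough for the lemma);
* `exists_measure_of_eventual_rates` — bounds for large `r` only (with constants `k, l`) ⇒
  `∃ C > 0, ∀ a, ∀ b ≠ 0, C/|b|^{Q/σ+1} < |ξ - a/b|` (shift the sequences by the threshold `N`:
  `k₀ = 2 k e^{Q N}`, `l₀ = l e^{-σ N}`);
* `irrational_of_eventual_rates`, `not_liouvilleWith_of_eventual_rates` — hence `ξ ∉ ℚ` and, in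
  Mathlib's vocabulary, `¬ LiouvilleWith p ξ` for every `p > 1 + Q/σ`: the irrationality exponent of
  `ξ` is at most `1 + Q/σ` (`= γ/(γ-1)` in Brown–Zudilin's worthiness normalisation `γ = 1 + σ/Q`).

How a certificate feeds this (cell `CRITERIA.md` C4): FORMAT A gives `q_r = D_r u_r`,
`p_r = D_r v_r`, `Q = Q' + δ`, `σ = μ₁ = 2Q_low - Q' - w - δ`, non-proportionality from the
Casoratian (`W_r ≠ 0` for all large `r`, automatic for a second-order recurrence with `t_r ≠ 0`);
FORMAT B gives `q_r = D_r b_r/Φ_r`, `p_r = -D_r a_r/Φ_r`, `σ = c + φ - δ`, `Q = b + δ - φ`.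
No cell-topic module is imported (gate `lint.import`), so the statements are over raw sequences.
-/

noncomputable section

open Filter Topology Real

namespace Summit.KontsevichZagierPeriods.Zeta5Search

/-! ### Bounds for every `r` ⇒ a measure for every denominator -/

/-- **C4 for all denominators.** Let `σ, Q, k₀, l₀ > 0` and integers `p_r, q_r` with
`|q_r| < k₀ e^{Q r}`, `|q_r ξ - p_r| ≤ l₀ e^{-σ r}`, `p_r q_{r+1} ≠ p_{r+1} q_r` for every `r`. Then
for ALL integers `a` and `b ≠ 0`, with `m = ⌈1/(2 l₀)⌉`:
`1 / (2 k₀ e^{Q} (2 e^{σ} l₀)^{Q/σ} m^{Q/σ+1} |b|^{Q/σ+1}) < |ξ - a/b|`.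
(The tree's Chen–Voutier lemma applied to the fraction `(a m)/(b m)`, whose denominator satisfies
`|b m| ≥ m ≥ 1/(2 l₀)`.) -/
theorem lt_abs_sub_div_of_rates {ξ σ Q k₀ l₀ : ℝ} (hσ : 0 < σ) (hQ : 0 < Q) (hk₀ : 0 < k₀)
    (hl₀ : 0 < l₀) {p q : ℕ → ℤ} (hq : ∀ r : ℕ, |(q r : ℝ)| < k₀ * Real.exp (Q * r))
    (happrox : ∀ r : ℕ, |(q r : ℝ) * ξ - p r| ≤ l₀ * Real.exp (-(σ * r)))
    (hne : ∀ r : ℕ, p r * q (r + 1) ≠ p (r + 1) * q r) (a b : ℤ) (hb : b ≠ 0) :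
    1 / (2 * k₀ * Real.exp Q * (2 * Real.exp σ * l₀) ^ (Q / σ) *
        (⌈1 / (2 * l₀)⌉₊ : ℝ) ^ (Q / σ + 1) * |(b : ℝ)| ^ (Q / σ + 1)) < |ξ - a / b| := by
  set m : ℕ := ⌈1 / (2 * l₀)⌉₊ with hm
  have hm1 : 1 ≤ m := Nat.one_le_ceil_iff.2 (by positivity)
  have hm0 : (0 : ℝ) < m := by exact_mod_cast hm1
  have hmle : 1 / (2 * l₀) ≤ (m : ℝ) := Nat.le_ceil _
  -- the tree's lemma in exponential rates (as in `Measure.lean`)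
  have hE : 1 < Real.exp σ := Real.one_lt_exp_iff.2 hσ
  have hQ' : 1 < Real.exp Q := Real.one_lt_exp_iff.2 hQ
  have hκ : Real.log (Real.exp Q) / Real.log (Real.exp σ) = Q / σ := by
    rw [Real.log_exp, Real.log_exp]
  have hq' : ∀ r : ℕ, |(q r : ℝ)| < k₀ * Real.exp Q ^ r := by
    intro r
    have e : Real.exp Q ^ r = Real.exp (Q * r) := by rw [← Real.exp_nat_mul]; ring_nf
    rw [e]; exact hq r
  have happrox' : ∀ r : ℕ, |(q r : ℝ) * ξ - p r| ≤ l₀ / Real.exp σ ^ r := by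
    intro r
    have e : l₀ / Real.exp σ ^ r = l₀ * Real.exp (-(σ * r)) := by
      rw [← Real.exp_nat_mul, Real.exp_neg, div_eq_mul_inv]; ring_nf
    rw [e]; exact happrox r
  -- apply it to `(a m)/(b m)`
  have hbm : 1 / (2 * l₀) ≤ |((b * m : ℤ) : ℝ)| := by
    have hb1 : (1 : ℝ) ≤ |(b : ℝ)| := by
      have : (1 : ℤ) ≤ |b| := Int.one_le_abs hb
      have h' : ((1 : ℤ) : ℝ) ≤ ((|b| : ℤ) : ℝ) := by exact_mod_cast this
      simpa [Int.cast_abs] using h'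
    push_cast
    rw [abs_mul, Nat.abs_cast]
    calc 1 / (2 * l₀) ≤ (m : ℝ) := hmle
      _ = 1 * m := (one_mul _).symm
      _ ≤ |(b : ℝ)| * m := mul_le_mul_of_nonneg_right hb1 hm0.le
  have h := Literature.NumberTheory.DiophantineApproximation.one_div_lt_abs_sub_div_of_approx
    hk₀ hl₀ hE hQ' hq' happrox' hne (a * m) (b * m) hbm
  rw [hκ] at h
  have hfrac : ((a * m : ℤ) : ℝ) / ((b * m : ℤ) : ℝ) = a / b := by
    push_cast
    rw [mul_div_mul_right _ _ hm0.ne']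
  have habs : |((b * m : ℤ) : ℝ)| ^ (Q / σ + 1) = (m : ℝ) ^ (Q / σ + 1) * |(b : ℝ)| ^ (Q / σ + 1) := by
    push_cast
    rw [abs_mul, Nat.abs_cast, Real.mul_rpow (abs_nonneg _) hm0.le, mul_comm]
  rw [hfrac, habs, ← mul_assoc] at h
  exact h

/-! ### Eventual bounds ⇒ a measure (shift of the index) -/

/-- **C4 from eventual data.** Let `σ, Q, k, l > 0` and integers `p_r, q_r` with, for all large
`r`: `|q_r| ≤ k e^{Q r}`, `|q_r ξ - p_r| ≤ l e^{-σ r}` and `p_r q_{r+1} ≠ p_{r+1} q_r`. Then there is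
`C > 0` with `C / |b|^{Q/σ + 1} < |ξ - a/b|` for all integers `a` and `b ≠ 0`: the irrationality
exponent of `ξ` is at most `1 + Q/σ`, effectively in terms of the threshold index. -/
theorem exists_measure_of_eventual_rates {ξ σ Q k l : ℝ} (hσ : 0 < σ) (hQ : 0 < Q) (hk : 0 < k)
    (hl : 0 < l) {p q : ℕ → ℤ} (hq : ∀ᶠ r : ℕ in atTop, |(q r : ℝ)| ≤ k * Real.exp (Q * r))
    (happrox : ∀ᶠ r : ℕ in atTop, |(q r : ℝ) * ξ - p r| ≤ l * Real.exp (-(σ * r)))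
    (hne : ∀ᶠ r : ℕ in atTop, p r * q (r + 1) ≠ p (r + 1) * q r) :
    ∃ C : ℝ, 0 < C ∧ ∀ a b : ℤ, b ≠ 0 → C / |(b : ℝ)| ^ (Q / σ + 1) < |ξ - a / b| := by
  obtain ⟨N, hN⟩ := eventually_atTop.1 (hq.and (happrox.and hne))
  -- shifted sequences
  set p' : ℕ → ℤ := fun r => p (r + N) with hp'
  set q' : ℕ → ℤ := fun r => q (r + N) with hq'
  set k₀ : ℝ := 2 * k * Real.exp (Q * N) with hk₀
  set l₀ : ℝ := l * Real.exp (-(σ * N)) with hl₀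
  have hk₀0 : 0 < k₀ := by positivity
  have hl₀0 : 0 < l₀ := by positivity
  have h1 : ∀ r : ℕ, |(q' r : ℝ)| < k₀ * Real.exp (Q * r) := by
    intro r
    have h := (hN (r + N) (Nat.le_add_left N r)).1
    have e : k * Real.exp (Q * ((r + N : ℕ) : ℝ)) = k * Real.exp (Q * N) * Real.exp (Q * r) := by
      rw [mul_assoc, ← Real.exp_add]; congr 1; push_cast; ring
    rw [e] at h
    have hpos : 0 < k * Real.exp (Q * N) * Real.exp (Q * r) := by positivity
    calc |(q' r : ℝ)| ≤ k * Real.exp (Q * N) * Real.exp (Q * r) := h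
      _ < 2 * k * Real.exp (Q * N) * Real.exp (Q * r) := by linarith
  have h2 : ∀ r : ℕ, |(q' r : ℝ) * ξ - p' r| ≤ l₀ * Real.exp (-(σ * r)) := by
    intro r
    have h := (hN (r + N) (Nat.le_add_left N r)).2.1
    have e : l * Real.exp (-(σ * ((r + N : ℕ) : ℝ))) = l₀ * Real.exp (-(σ * r)) := by
      rw [hl₀, mul_assoc, ← Real.exp_add]; congr 1; push_cast; ring
    rw [e] at h
    exact h
  have h3 : ∀ r : ℕ, p' r * q' (r + 1) ≠ p' (r + 1) * q' r := by
    intro r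
    have h := (hN (r + N) (Nat.le_add_left N r)).2.2
    simp only [hp', hq']
    rw [show r + 1 + N = r + N + 1 by ring]
    exact h
  refine ⟨1 / (2 * k₀ * Real.exp Q * (2 * Real.exp σ * l₀) ^ (Q / σ) *
      (⌈1 / (2 * l₀)⌉₊ : ℝ) ^ (Q / σ + 1)), by positivity, fun a b hb => ?_⟩
  have h := lt_abs_sub_div_of_rates hσ hQ hk₀0 hl₀0 h1 h2 h3 a b hb
  rw [div_div]
  exact h

/-- **A measure forces irrationality**: if `C/|b|^{κ} < |ξ - a/b|` for all `a` and `b ≠ 0` then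
`ξ ∉ ℚ`. -/
theorem irrational_of_measure {ξ C κ : ℝ} (hC : 0 < C)
    (h : ∀ a b : ℤ, b ≠ 0 → C / |(b : ℝ)| ^ κ < |ξ - a / b|) : Irrational ξ := by
  rw [irrational_iff_ne_rational]
  intro a b hb hab
  have h1 := h a b hb
  rw [hab, sub_self, abs_zero] at h1
  have : 0 ≤ C / |(b : ℝ)| ^ κ := by positivity
  linarith

/-- **C4 ⇒ irrational** (eventual data). -/
theorem irrational_of_eventual_rates {ξ σ Q k l : ℝ} (hσ : 0 < σ) (hQ : 0 < Q) (hk : 0 < k)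
    (hl : 0 < l) {p q : ℕ → ℤ} (hq : ∀ᶠ r : ℕ in atTop, |(q r : ℝ)| ≤ k * Real.exp (Q * r))
    (happrox : ∀ᶠ r : ℕ in atTop, |(q r : ℝ) * ξ - p r| ≤ l * Real.exp (-(σ * r)))
    (hne : ∀ᶠ r : ℕ in atTop, p r * q (r + 1) ≠ p (r + 1) * q r) : Irrational ξ := by
  obtain ⟨C, hC, h⟩ := exists_measure_of_eventual_rates hσ hQ hk hl hq happrox hne
  exact irrational_of_measure hC h

/-- **A measure bounds the irrationality exponent** (Mathlib's `LiouvilleWith`): if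
`C/|b|^{κ} < |ξ - a/b|` for all `a` and `b ≠ 0` (`C > 0`) then `¬ LiouvilleWith p ξ` for every
`p > κ`. -/
theorem not_liouvilleWith_of_measure {ξ C κ : ℝ} (hC : 0 < C)
    (h : ∀ a b : ℤ, b ≠ 0 → C / |(b : ℝ)| ^ κ < |ξ - a / b|) {p : ℝ} (hp : κ < p) :
    ¬ LiouvilleWith p ξ := by
  intro hL
  obtain ⟨C', hC'0, hfreq⟩ := hL.exists_pos
  -- for large `n`, `C' / n^p ≤ C / n^κ`
  have hev : ∀ᶠ n : ℕ in atTop, C' / (n : ℝ) ^ p ≤ C / (n : ℝ) ^ κ := by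
    have ht : Tendsto (fun n : ℕ => (n : ℝ) ^ (p - κ)) atTop atTop :=
      (tendsto_rpow_atTop (by linarith)).comp tendsto_natCast_atTop_atTop
    filter_upwards [ht.eventually_ge_atTop (C' / C), eventually_gt_atTop 0] with n hn hn0
    have hn0' : (0 : ℝ) < n := by exact_mod_cast hn0
    rw [div_le_div_iff₀ (Real.rpow_pos_of_pos hn0' _) (Real.rpow_pos_of_pos hn0' _)]
    have e : (n : ℝ) ^ p = (n : ℝ) ^ κ * (n : ℝ) ^ (p - κ) := by
      rw [← Real.rpow_add hn0']; ring_nf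
    rw [e]
    have h1 : C' ≤ C * (n : ℝ) ^ (p - κ) := by
      rw [div_le_iff₀ hC] at hn; linarith
    calc C' * (n : ℝ) ^ κ ≤ C * (n : ℝ) ^ (p - κ) * (n : ℝ) ^ κ :=
          mul_le_mul_of_nonneg_right h1 (Real.rpow_nonneg hn0'.le _)
      _ = C * ((n : ℝ) ^ κ * (n : ℝ) ^ (p - κ)) := by ring
  obtain ⟨n, ⟨hn1, m, _, hlt⟩, hle⟩ := (hfreq.and_eventually hev).exists
  have hn0 : (n : ℤ) ≠ 0 := by exact_mod_cast (Nat.one_le_iff_ne_zero.1 hn1)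
  have h1 := h m n hn0
  rw [Int.cast_natCast, Nat.abs_cast] at h1
  linarith

/-- **C4 ⇒ irrationality exponent `≤ 1 + Q/σ`** (eventual data): `¬ LiouvilleWith p ξ` for every
`p > Q/σ + 1`. -/
theorem not_liouvilleWith_of_eventual_rates {ξ σ Q k l : ℝ} (hσ : 0 < σ) (hQ : 0 < Q)
    (hk : 0 < k) (hl : 0 < l) {p q : ℕ → ℤ}
    (hq : ∀ᶠ r : ℕ in atTop, |(q r : ℝ)| ≤ k * Real.exp (Q * r))
    (happrox : ∀ᶠ r : ℕ in atTop, |(q r : ℝ) * ξ - p r| ≤ l * Real.exp (-(σ * r)))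
    (hne : ∀ᶠ r : ℕ in atTop, p r * q (r + 1) ≠ p (r + 1) * q r) {expo : ℝ}
    (hexpo : Q / σ + 1 < expo) : ¬ LiouvilleWith expo ξ := by
  obtain ⟨C, hC, h⟩ := exists_measure_of_eventual_rates hσ hQ hk hl hq happrox hne
  exact not_liouvilleWith_of_measure hC h hexpo

end Summit.KontsevichZagierPeriods.Zeta5Search
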